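import Literature.NumberTheory.EllipticCurves.TateCurve.UniformizationValues
import HarnessLib

/-!
# Silverman ATAEC §V.4: the levels of `φ(u) = (X(u,q), Y(u,q))` for `√|q| ≤ |u| < 1`
# (block A of the surjectivity step: `φ` meets every class `U`, `V`, `W`)

J. H. Silverman, *Advanced Topics in the Arithmetic of Elliptic Curves*, GTM 151, §V.4, proof of
Prop. 4.1 / Lemma 4.1.2, PDF pp. 400–404 [cite: SilvermanATAEC1994, Lemma V.4.1.2 (PDF p. 403)].  The
print proves surjectivity of `φ : K* → E_q(K)` by counting cosets (`#E_q(K)/E_{q,0}(K) ≤ ord_v q`);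
the uniformiser-free form used in this programme (split with abc-iut-L2-t5 / abc-iut-L6-t5, cell
INBOX 2026-08-25) replaces the count by LEVEL MATCHING: every class of Lemma 4.1.2 —
`V_r = {‖y‖ < ‖x+y‖ = r}`, `U_r = {‖x+y‖ < ‖y‖ = r}` (`r² > ‖q‖`, `r < 1`), `W = {‖y‖² = ‖x+y‖² =
‖q‖}` — contains a point `φ(u)`: namely `φ(u) ∈ V_{‖u‖}` for `√‖q‖ < ‖u‖ < 1`, `φ(u) ∈ W` for
`‖u‖² = ‖q‖`, and `φ(u) ∈ U_{‖u⁻¹‖}` for `1 < ‖u‖ < 1/√‖q‖` (by `−φ(u) = φ(u⁻¹)`).  This rests on the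
two-term approximations on the annulus `√‖q‖ ≤ ‖u‖ < 1` (terms `n = 0` and `n = −1` of the series,
everything else being `O(q)`):

  `‖X(u) − u/(1−u)² − (q/u)/(1−q/u)²‖ ≤ ‖q‖`,
  `‖Y(u) − u²/(1−u)³ + (q/u)²/(1−q/u)³ + (q/u)/(1−q/u)²‖ ≤ ‖q‖`

(`norm_tateX_sub_two_le`, `norm_tateY_sub_two_le`), whence `tate_mem_V`, `tate_mem_W`, `tate_mem_U`.
Complete ultrametric field, `‖q‖ < 1`.  Classical.  Seat abc-iut-L2-t6.
-/

noncomputable section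

namespace Literature.NumberTheory.EllipticCurves.TateCurve

open SteinWuthrich2013 Filter Topology IsUltrametricDist

variable {L : Type*} [NontriviallyNormedField L] [CompleteSpace L] [IsUltrametricDist L] {q u : L}

/-! ### Sizes on the annulus `‖q‖ ≤ ‖u‖²`, `‖u‖ < 1` -/

omit [CompleteSpace L] [IsUltrametricDist L] in
/-- On the annulus: `‖q‖ ≤ ‖u‖` (from `‖q‖ ≤ ‖u‖² ≤ ‖u‖`). [cite: SilvermanATAEC1994, Lemma V.4.1.2 (PDF p. 403)] -/
theorem norm_q_le_of_annulus (hu1 : ‖u‖ < 1) (hqu : ‖q‖ ≤ ‖u‖ ^ 2) : ‖q‖ ≤ ‖u‖ :=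
  hqu.trans (by nlinarith [norm_nonneg u])

omit [CompleteSpace L] [IsUltrametricDist L] in
/-- `‖qᵐu⁻¹‖ ≤ ‖q‖` for `m ≥ 2`, `‖q‖ ≤ ‖u‖`, `u ≠ 0`, `‖q‖ < 1`. [cite: SilvermanATAEC1994, Lemma V.4.1.2 (PDF p. 403)] -/
theorem norm_pow_mul_inv_le (hq : ‖q‖ < 1) (hu0 : u ≠ 0) (hqu : ‖q‖ ≤ ‖u‖) {m : ℕ} (hm : 2 ≤ m) :
    ‖q ^ m * u⁻¹‖ ≤ ‖q‖ := by
  have hu : 0 < ‖u‖ := norm_pos_iff.mpr hu0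
  obtain ⟨k, rfl⟩ : ∃ k, m = k + 2 := ⟨m - 2, by omega⟩
  rw [norm_mul, norm_inv, norm_pow, pow_add, pow_two]
  calc ‖q‖ ^ k * (‖q‖ * ‖q‖) * ‖u‖⁻¹ = ‖q‖ ^ k * ‖q‖ * (‖q‖ / ‖u‖) := by ring
    _ ≤ 1 * ‖q‖ * 1 := by
        gcongr
        · exact pow_le_one₀ (norm_nonneg q) hq.le
        · exact (div_le_one hu).mpr hqu
    _ = ‖q‖ := by ring

omit [CompleteSpace L] [IsUltrametricDist L] in
/-- `‖qᵐu‖ ≤ ‖q‖ < 1`-type bound: `‖qᵐ u‖ ≤ ‖q‖` for `m ≥ 1`, `‖u‖ < 1`. [cite: SilvermanATAEC1994, Lemma V.4.1.2 (PDF p. 403)] -/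
theorem norm_pow_mul_le (hq : ‖q‖ < 1) (hu1 : ‖u‖ < 1) {m : ℕ} (hm : m ≠ 0) :
    ‖q ^ m * u‖ ≤ ‖q‖ := by
  rw [norm_mul, norm_pow]
  calc ‖q‖ ^ m * ‖u‖ ≤ ‖q‖ ^ m * 1 := by gcongr
    _ ≤ ‖q‖ := by rw [mul_one]; exact pow_le_of_le_one (norm_nonneg q) hq.le hm

omit [CompleteSpace L] in
/-- `‖v/(1−v)²‖ = ‖v‖` and `‖v²/(1−v)³‖ = ‖v‖²` for `‖v‖ < 1`. [cite: SilvermanATAEC1994, Lemma V.4.1.2 (PDF p. 403)] -/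
theorem norm_div_one_sub_sq {v : L} (hv : ‖v‖ < 1) : ‖v / (1 - v) ^ 2‖ = ‖v‖ := by
  rw [norm_div, norm_pow, norm_one_sub_eq_one hv, one_pow, div_one]

omit [CompleteSpace L] in
/-- See `norm_div_one_sub_sq`. [cite: SilvermanATAEC1994, Lemma V.4.1.2 (PDF p. 403)] -/
theorem norm_sq_div_one_sub_cube {v : L} (hv : ‖v‖ < 1) : ‖v ^ 2 / (1 - v) ^ 3‖ = ‖v‖ ^ 2 := by
  rw [norm_div, norm_pow, norm_pow, norm_one_sub_eq_one hv, one_pow, div_one]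

omit [CompleteSpace L] in
/-- Terms of index `n ∉ {0, −1}` of the `X`-series are `O(q)` on the annulus `‖q‖ ≤ ‖u‖²`,
`‖u‖ < 1`, `u ≠ 0`. [cite: SilvermanATAEC1994, Lemma V.4.1.2 (PDF p. 403)] -/
theorem norm_tateXTerm_le_of_annulus (hq : ‖q‖ < 1) (hu0 : u ≠ 0) (hu1 : ‖u‖ < 1)
    (hqu : ‖q‖ ≤ ‖u‖ ^ 2) {n : ℤ} (hn0 : n ≠ 0) (hn1 : n ≠ -1) : ‖tateXTerm q u n‖ ≤ ‖q‖ := by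
  have hqu' := norm_q_le_of_annulus hu1 hqu
  rcases Int.eq_nat_or_neg n with ⟨m, rfl | rfl⟩
  · have hm : m ≠ 0 := fun h => hn0 (by rw [h, Nat.cast_zero])
    have hle := norm_pow_mul_le hq hu1 hm
    rw [tateXTerm, zpow_natCast, norm_div_one_sub_sq (lt_of_le_of_lt hle hq)]
    exact hle
  · have hm2 : 2 ≤ m := by omega
    have hle := norm_pow_mul_inv_le hq hu0 hqu' hm2
    rw [← tateXTerm_inv, tateXTerm, zpow_natCast, norm_div_one_sub_sq (lt_of_le_of_lt hle hq)]
    exact hle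

omit [CompleteSpace L] in
/-- Terms of index `n ∉ {0, −1}` of the `Y`-series are `O(q)` on the annulus.
[cite: SilvermanATAEC1994, Lemma V.4.1.2 (PDF p. 403)] -/
theorem norm_tateYTerm_le_of_annulus (hq : ‖q‖ < 1) (hu0 : u ≠ 0) (hu1 : ‖u‖ < 1)
    (hqu : ‖q‖ ≤ ‖u‖ ^ 2) {n : ℤ} (hn0 : n ≠ 0) (hn1 : n ≠ -1) : ‖tateYTerm q u n‖ ≤ ‖q‖ := by
  have hqu' := norm_q_le_of_annulus hu1 hqu
  have hsq : ∀ {v : L}, ‖v‖ ≤ ‖q‖ → ‖v ^ 2 / (1 - v) ^ 3‖ ≤ ‖q‖ := by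
    intro v hv
    have hv1 : ‖v‖ < 1 := lt_of_le_of_lt hv hq
    rw [norm_sq_div_one_sub_cube hv1]
    calc ‖v‖ ^ 2 = ‖v‖ * ‖v‖ := sq _
      _ ≤ ‖q‖ * 1 := mul_le_mul hv hv1.le (norm_nonneg _) (norm_nonneg _)
      _ = ‖q‖ := mul_one _
  rcases Int.eq_nat_or_neg n with ⟨m, rfl | rfl⟩
  · have hm : m ≠ 0 := fun h => hn0 (by rw [h, Nat.cast_zero])
    rw [tateYTerm, zpow_natCast]
    exact hsq (norm_pow_mul_le hq hu1 hm)
  · have hm2 : 2 ≤ m := by omega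
    have hle := norm_pow_mul_inv_le hq hu0 hqu' hm2
    -- `Yterm(u, -m) = -Yterm(u⁻¹, m) - Xterm(u⁻¹, m)`
    have h' : tateYTerm q u (-(m : ℤ)) = -tateYTerm q u⁻¹ m - tateXTerm q u⁻¹ m := by
      have h := tateYTerm_inv q u⁻¹ (-(m : ℤ))
      rwa [inv_inv, neg_neg] at h
    rw [h', sub_eq_add_neg]
    refine (norm_add_le_max _ _).trans (max_le ?_ ?_)
    · rw [norm_neg, tateYTerm, zpow_natCast]; exact hsq hle
    · rw [norm_neg, tateXTerm, zpow_natCast, norm_div_one_sub_sq (lt_of_le_of_lt hle hq)]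
      exact hle

/-! ### The two-term approximations of `X` and `Y` on the annulus -/

omit [CompleteSpace L] [IsUltrametricDist L] in
/-- Splitting a sum over `ℤ` off the indices `0` and `−1`.
[cite: SilvermanATAEC1994, Lemma V.4.1.2 (PDF p. 403)] -/
theorem tsum_int_eq_add_add_tsum {f : ℤ → L} (hf : Summable f) :
    ∑' n : ℤ, f n = f 0 + f (-1) + ∑' n : ℤ, (if n = 0 ∨ n = -1 then 0 else f n) := by
  rw [hf.tsum_eq_add_tsum_ite 0]
  have hg : Summable fun n : ℤ => if n = 0 then 0 else f n :=
    (hf.update 0 0).congr fun n => by rw [Function.update_apply]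
  rw [hg.tsum_eq_add_tsum_ite (-1), if_neg (by norm_num : (-1 : ℤ) ≠ 0), add_assoc]
  congr 2
  refine tsum_congr fun n => ?_
  by_cases h0 : n = 0
  · simp [h0]
  · by_cases h1 : n = -1
    · simp [h1]
    · simp [h0, h1]

/-- **Two-term approximation of `X` on the annulus** `‖q‖ ≤ ‖u‖² `, `‖u‖ < 1` (`u ≠ 0`,
`‖q‖ < 1`, complete ultrametric field): `‖X(u,q) − u/(1−u)² − (q/u)/(1−q/u)²‖ ≤ ‖q‖`.
[cite: SilvermanATAEC1994, Lemma V.4.1.2 (PDF p. 403)] -/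
theorem norm_tateX_sub_two_le (hq : ‖q‖ < 1) (hu0 : u ≠ 0) (hu1 : ‖u‖ < 1)
    (hqu : ‖q‖ ≤ ‖u‖ ^ 2) :
    ‖tateX q u - u / (1 - u) ^ 2 - (q / u) / (1 - q / u) ^ 2‖ ≤ ‖q‖ := by
  have hS := summable_tateXTerm hq u
  have h0 : tateXTerm q u 0 = u / (1 - u) ^ 2 := by simp [tateXTerm]
  have h1 : tateXTerm q u (-1) = (q / u) / (1 - q / u) ^ 2 := by
    rw [show (-1 : ℤ) = -((1 : ℕ) : ℤ) by norm_num, ← tateXTerm_inv, tateXTerm, zpow_natCast,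
      pow_one, div_eq_mul_inv q u]
  have hrest : ‖∑' n : ℤ, (if n = 0 ∨ n = -1 then 0 else tateXTerm q u n)‖ ≤ ‖q‖ := by
    refine norm_tsum_le_of_forall_le_of_nonneg (norm_nonneg q) fun n => ?_
    split_ifs with hn
    · rw [norm_zero]; exact norm_nonneg q
    · push Not at hn
      exact norm_tateXTerm_le_of_annulus hq hu0 hu1 hqu hn.1 hn.2
  have h2s : ‖2 * tateS 1 q‖ ≤ ‖q‖ := by
    rw [norm_mul]
    calc ‖(2 : L)‖ * ‖tateS 1 q‖ ≤ 1 * ‖q‖ :=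
          mul_le_mul (by exact_mod_cast norm_natCast_le_one L 2) (norm_tateS_one_le hq)
            (norm_nonneg _) zero_le_one
      _ = ‖q‖ := one_mul _
  have hX : tateX q u - u / (1 - u) ^ 2 - (q / u) / (1 - q / u) ^ 2 =
      (∑' n : ℤ, (if n = 0 ∨ n = -1 then 0 else tateXTerm q u n)) - 2 * tateS 1 q := by
    rw [tateX, tsum_int_eq_add_add_tsum hS, h0, h1]; ring
  rw [hX, sub_eq_add_neg]
  refine (norm_add_le_max _ _).trans (max_le hrest ?_)
  rwa [norm_neg]

/-- **Two-term approximation of `Y` on the annulus**: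
`‖Y(u,q) − u²/(1−u)³ + (q/u)²/(1−q/u)³ + (q/u)/(1−q/u)²‖ ≤ ‖q‖` (the index `−1` term of the
`Y`-series is `−(q/u)²/(1−q/u)³ − (q/u)/(1−q/u)²`). [cite: SilvermanATAEC1994, Lemma V.4.1.2 (PDF p. 403)] -/
theorem norm_tateY_sub_two_le (hq : ‖q‖ < 1) (hu0 : u ≠ 0) (hu1 : ‖u‖ < 1)
    (hqu : ‖q‖ ≤ ‖u‖ ^ 2) :
    ‖tateY q u - u ^ 2 / (1 - u) ^ 3 + (q / u) ^ 2 / (1 - q / u) ^ 3 + (q / u) / (1 - q / u) ^ 2‖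
      ≤ ‖q‖ := by
  have hS := summable_tateYTerm hq u
  have h0 : tateYTerm q u 0 = u ^ 2 / (1 - u) ^ 3 := by simp [tateYTerm]
  have h1 : tateYTerm q u (-1) = -((q / u) ^ 2 / (1 - q / u) ^ 3) - (q / u) / (1 - q / u) ^ 2 := by
    have h := tateYTerm_inv q u⁻¹ (-1)
    rw [inv_inv, neg_neg] at h
    rw [h, tateYTerm, tateXTerm, zpow_one, ← div_eq_mul_inv q u]
  have hrest : ‖∑' n : ℤ, (if n = 0 ∨ n = -1 then 0 else tateYTerm q u n)‖ ≤ ‖q‖ := by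
    refine norm_tsum_le_of_forall_le_of_nonneg (norm_nonneg q) fun n => ?_
    split_ifs with hn
    · rw [norm_zero]; exact norm_nonneg q
    · push Not at hn
      exact norm_tateYTerm_le_of_annulus hq hu0 hu1 hqu hn.1 hn.2
  have hY : tateY q u - u ^ 2 / (1 - u) ^ 3 + (q / u) ^ 2 / (1 - q / u) ^ 3
      + (q / u) / (1 - q / u) ^ 2 =
      (∑' n : ℤ, (if n = 0 ∨ n = -1 then 0 else tateYTerm q u n)) + tateS 1 q := by
    rw [tateY, tsum_int_eq_add_add_tsum hS, h0, h1]; ring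
  rw [hY]
  exact (norm_add_le_max _ _).trans (max_le hrest (norm_tateS_one_le hq))

/-! ### Level matching: `φ(u)` lies in `V`, `W`, `U` -/

/-- **`φ(u) ∈ V_{‖u‖}` for `√‖q‖ < ‖u‖ < 1`**: `‖Y(u)‖ < ‖X(u) + Y(u)‖ = ‖u‖`
(the term `u/(1−u)²` dominates `X + Y`; every term of `Y` is `< ‖u‖`).
[cite: SilvermanATAEC1994, Lemma V.4.1.2 (PDF p. 403)] -/
theorem tate_mem_V (hq : ‖q‖ < 1) (hu1 : ‖u‖ < 1) (hqu : ‖q‖ < ‖u‖ ^ 2) :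
    ‖tateY q u‖ < ‖tateX q u + tateY q u‖ ∧ ‖tateX q u + tateY q u‖ = ‖u‖ := by
  set r := ‖u‖ with hr
  have hr0 : 0 < r := by
    rcases (norm_nonneg u).lt_or_eq with h | h
    · exact h
    · exfalso
      rw [← hr] at h
      rw [← h] at hqu
      norm_num at hqu
      linarith [norm_nonneg q]
  have hu0 : u ≠ 0 := norm_pos_iff.mp hr0
  have hq0 : 0 ≤ ‖q‖ := norm_nonneg q
  -- sizes of the four explicit terms
  have hA : ‖u / (1 - u) ^ 2‖ = r := norm_div_one_sub_sq hu1
  have hY0 : ‖u ^ 2 / (1 - u) ^ 3‖ = r ^ 2 := norm_sq_div_one_sub_cube hu1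
  have hqur : ‖q / u‖ = ‖q‖ / r := by rw [norm_div]
  have hqu1 : ‖q / u‖ < r := by
    rw [hqur, div_lt_iff₀ hr0, ← sq]; exact hqu
  have hqu1' : ‖q / u‖ < 1 := hqu1.trans hu1
  have hB : ‖(q / u) / (1 - q / u) ^ 2‖ = ‖q‖ / r := by rw [norm_div_one_sub_sq hqu1', hqur]
  have hB' : ‖(q / u) ^ 2 / (1 - q / u) ^ 3‖ = (‖q‖ / r) ^ 2 := by
    rw [norm_sq_div_one_sub_cube hqu1', hqur]
  have hr2 : r ^ 2 < r := by nlinarith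
  have hBr : ‖q‖ / r < r := hqur ▸ hqu1
  have hB'r : (‖q‖ / r) ^ 2 < r := by
    have h1 : (‖q‖ / r) ^ 2 ≤ (‖q‖ / r) * 1 := by
      rw [sq]; exact mul_le_mul_of_nonneg_left (hqur ▸ hqu1'.le) (div_nonneg hq0 hr0.le)
    linarith
  have hqr : ‖q‖ < r := lt_of_lt_of_le hqu (by nlinarith)
  have hEX := norm_tateX_sub_two_le hq hu0 hu1 hqu.le
  have hEY := norm_tateY_sub_two_le hq hu0 hu1 hqu.le
  -- `X + Y = A + Y₀ − B' + (E_X + E_Y)`: norm `= r`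
  have hsum : tateX q u + tateY q u = u / (1 - u) ^ 2 + (u ^ 2 / (1 - u) ^ 3
      - (q / u) ^ 2 / (1 - q / u) ^ 3
      + ((tateX q u - u / (1 - u) ^ 2 - (q / u) / (1 - q / u) ^ 2)
        + (tateY q u - u ^ 2 / (1 - u) ^ 3 + (q / u) ^ 2 / (1 - q / u) ^ 3
            + (q / u) / (1 - q / u) ^ 2))) := by ring
  have hsmall : ‖u ^ 2 / (1 - u) ^ 3 - (q / u) ^ 2 / (1 - q / u) ^ 3
      + ((tateX q u - u / (1 - u) ^ 2 - (q / u) / (1 - q / u) ^ 2)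
        + (tateY q u - u ^ 2 / (1 - u) ^ 3 + (q / u) ^ 2 / (1 - q / u) ^ 3
            + (q / u) / (1 - q / u) ^ 2))‖ < r := by
    refine lt_of_le_of_lt (norm_add_le_max _ _) (max_lt ?_ ?_)
    · rw [sub_eq_add_neg]
      refine lt_of_le_of_lt (norm_add_le_max _ _) (max_lt (hY0 ▸ hr2) ?_)
      rw [norm_neg, hB']; exact hB'r
    · exact lt_of_le_of_lt (norm_add_le_max _ _) (max_lt (lt_of_le_of_lt hEX hqr)
        (lt_of_le_of_lt hEY hqr))
  have hXY : ‖tateX q u + tateY q u‖ = r := by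
    rw [hsum, norm_add_eq_max_of_norm_ne_norm (by rw [hA]; exact ne_of_gt hsmall), hA,
      max_eq_left hsmall.le]
  refine ⟨?_, hXY⟩
  -- `Y = Y₀ − B' − B + E_Y`: every piece `< r`
  rw [hXY]
  have hYeq : tateY q u = u ^ 2 / (1 - u) ^ 3 + (-((q / u) ^ 2 / (1 - q / u) ^ 3)
      + (-((q / u) / (1 - q / u) ^ 2)
        + (tateY q u - u ^ 2 / (1 - u) ^ 3 + (q / u) ^ 2 / (1 - q / u) ^ 3
            + (q / u) / (1 - q / u) ^ 2))) := by ring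
  rw [hYeq]
  refine lt_of_le_of_lt (norm_add_le_max _ _) (max_lt (hY0 ▸ hr2) ?_)
  refine lt_of_le_of_lt (norm_add_le_max _ _) (max_lt (by rw [norm_neg, hB']; exact hB'r) ?_)
  refine lt_of_le_of_lt (norm_add_le_max _ _) (max_lt (by rw [norm_neg, hB]; exact hBr) ?_)
  exact lt_of_le_of_lt hEY hqr

/-- **`φ(u) ∈ W` for `‖u‖² = ‖q‖`** (`‖q‖ < 1`, `q ≠ 0`): `‖Y(u)‖² = ‖q‖ = ‖X(u) + Y(u)‖²`
(`Y` is dominated by `−(q/u)/(1−q/u)²`, `X + Y` by `u/(1−u)²`, both of norm `√‖q‖`).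
[cite: SilvermanATAEC1994, Lemma V.4.1.2 (PDF p. 403)] -/
theorem tate_mem_W (hq : ‖q‖ < 1) (hq0 : q ≠ 0) (hqu : ‖u‖ ^ 2 = ‖q‖) :
    ‖tateY q u‖ ^ 2 = ‖q‖ ∧ ‖tateX q u + tateY q u‖ ^ 2 = ‖q‖ := by
  set r := ‖u‖ with hr
  have hqpos : 0 < ‖q‖ := norm_pos_iff.mpr hq0
  have hr0 : 0 < r := by
    rcases (norm_nonneg u).lt_or_eq with h | h
    · exact h
    · exfalso
      rw [← hr] at h
      rw [← h] at hqu
      norm_num at hqu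
      linarith
  have hu0 : u ≠ 0 := norm_pos_iff.mp hr0
  have hu1 : r < 1 := by
    by_contra h; rw [not_lt] at h
    have : 1 ≤ r ^ 2 := one_le_pow₀ h
    linarith
  have hr2 : r ^ 2 < r := by nlinarith
  have hA : ‖u / (1 - u) ^ 2‖ = r := norm_div_one_sub_sq hu1
  have hY0 : ‖u ^ 2 / (1 - u) ^ 3‖ = r ^ 2 := norm_sq_div_one_sub_cube hu1
  have hqur : ‖q / u‖ = r := by
    rw [norm_div, ← hqu, ← hr, sq, mul_div_assoc, div_self hr0.ne', mul_one]
  have hqu1' : ‖q / u‖ < 1 := hqur ▸ hu1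
  have hB : ‖(q / u) / (1 - q / u) ^ 2‖ = r := by rw [norm_div_one_sub_sq hqu1', hqur]
  have hB' : ‖(q / u) ^ 2 / (1 - q / u) ^ 3‖ = r ^ 2 := by
    rw [norm_sq_div_one_sub_cube hqu1', hqur]
  have hqr : ‖q‖ < r := by rw [← hqu]; exact hr2
  have hEX := norm_tateX_sub_two_le hq hu0 hu1 hqu.symm.le
  have hEY := norm_tateY_sub_two_le hq hu0 hu1 hqu.symm.le
  constructor
  · -- `Y = −B + (Y₀ − B' + E_Y)`, `‖B‖ = r`, rest `< r`
    have hYeq : tateY q u = -((q / u) / (1 - q / u) ^ 2) + (u ^ 2 / (1 - u) ^ 3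
        + (-((q / u) ^ 2 / (1 - q / u) ^ 3)
          + (tateY q u - u ^ 2 / (1 - u) ^ 3 + (q / u) ^ 2 / (1 - q / u) ^ 3
              + (q / u) / (1 - q / u) ^ 2))) := by ring
    have hsmall : ‖u ^ 2 / (1 - u) ^ 3 + (-((q / u) ^ 2 / (1 - q / u) ^ 3)
        + (tateY q u - u ^ 2 / (1 - u) ^ 3 + (q / u) ^ 2 / (1 - q / u) ^ 3
            + (q / u) / (1 - q / u) ^ 2))‖ < r := by
      refine lt_of_le_of_lt (norm_add_le_max _ _) (max_lt (hY0 ▸ hr2) ?_)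
      refine lt_of_le_of_lt (norm_add_le_max _ _) (max_lt (by rw [norm_neg, hB']; exact hr2) ?_)
      exact lt_of_le_of_lt hEY hqr
    rw [hYeq, norm_add_eq_max_of_norm_ne_norm (by rw [norm_neg, hB]; exact ne_of_gt hsmall),
      norm_neg, hB, max_eq_left hsmall.le, hqu]
  · have hsum : tateX q u + tateY q u = u / (1 - u) ^ 2 + (u ^ 2 / (1 - u) ^ 3
        - (q / u) ^ 2 / (1 - q / u) ^ 3
        + ((tateX q u - u / (1 - u) ^ 2 - (q / u) / (1 - q / u) ^ 2)
          + (tateY q u - u ^ 2 / (1 - u) ^ 3 + (q / u) ^ 2 / (1 - q / u) ^ 3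
              + (q / u) / (1 - q / u) ^ 2))) := by ring
    have hsmall : ‖u ^ 2 / (1 - u) ^ 3 - (q / u) ^ 2 / (1 - q / u) ^ 3
        + ((tateX q u - u / (1 - u) ^ 2 - (q / u) / (1 - q / u) ^ 2)
          + (tateY q u - u ^ 2 / (1 - u) ^ 3 + (q / u) ^ 2 / (1 - q / u) ^ 3
              + (q / u) / (1 - q / u) ^ 2))‖ < r := by
      refine lt_of_le_of_lt (norm_add_le_max _ _) (max_lt ?_ ?_)
      · rw [sub_eq_add_neg]
        refine lt_of_le_of_lt (norm_add_le_max _ _) (max_lt (hY0 ▸ hr2) ?_)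
        rw [norm_neg, hB']; exact hr2
      · exact lt_of_le_of_lt (norm_add_le_max _ _) (max_lt (lt_of_le_of_lt hEX hqr)
          (lt_of_le_of_lt hEY hqr))
    rw [hsum, norm_add_eq_max_of_norm_ne_norm (by rw [hA]; exact ne_of_gt hsmall), hA,
      max_eq_left hsmall.le, hqu]

omit [CompleteSpace L] [IsUltrametricDist L] in
/-- `−φ(u) = φ(u⁻¹)` on coordinates: `X(u⁻¹) + Y(u⁻¹) = −Y(u)` (from `X(u⁻¹) = X(u)`,
`Y(u⁻¹) = −Y(u) − X(u)`). [cite: SilvermanATAEC1994, Lemma V.4.1.4 (PDF p. 404)] -/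
theorem tateX_inv_add_tateY_inv [CompleteSpace L] (hq : ‖q‖ < 1) (u : L) :
    tateX q u⁻¹ + tateY q u⁻¹ = -tateY q u := by
  rw [tateX_inv, tateY_inv hq]; ring

/-- **`φ(u) ∈ U_{‖u⁻¹‖}` for `1 < ‖u‖ < 1/√‖q‖`**, stated through `v = u⁻¹` with `√‖q‖ < ‖v‖ < 1`:
`‖X(v⁻¹) + Y(v⁻¹)‖ < ‖Y(v⁻¹)‖ = ‖v‖` (negation swaps `U` and `V`).
[cite: SilvermanATAEC1994, Lemma V.4.1.2 (PDF p. 403)] -/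
theorem tate_mem_U {v : L} (hq : ‖q‖ < 1) (hv1 : ‖v‖ < 1) (hqv : ‖q‖ < ‖v‖ ^ 2) :
    ‖tateX q v⁻¹ + tateY q v⁻¹‖ < ‖tateY q v⁻¹‖ ∧ ‖tateY q v⁻¹‖ = ‖v‖ := by
  obtain ⟨hV, hlev⟩ := tate_mem_V hq hv1 hqv
  have h1 : tateX q v⁻¹ + tateY q v⁻¹ = -tateY q v := tateX_inv_add_tateY_inv hq v
  have h2 : tateY q v⁻¹ = -(tateX q v + tateY q v) := by rw [tateY_inv hq]; ring
  rw [h1, h2, norm_neg, norm_neg]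
  exact ⟨hV, hlev⟩

end Literature.NumberTheory.EllipticCurves.TateCurve

end
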